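import Summits.QuantumFields.YangMills.Theorems.UnitScaleGibbsWordTwoElitzurSU2
import HarnessLib

/-!
# The mean of the Hessian observable `∂_u∂_u A` of `SU(2)` lattice Yang–Mills in a raw region: EXACTLY the diagonal 1-form MASS plus the
# same-vertex corner terms — every other pair of insertions decorrelates (Elitzur chain (E2) → (E1) → (E2-SU2), displayed form)

Cell `ym3-torus` (rung R3 = continuum SU(2) Yang–Mills on T³ — NOT d = 4, NOT infinite volume, NOT a mass gap, NOT Clay); width seat `ym3-torus-px17` gen 7;
`--supports stmt-QuantumFields-23083 --as helper`.  The displayed corollary of ✓ `UnitScaleGibbsWordTwoElitzurSU2` announced with the (E2) plan (bus 2026-08-29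
19:23Z) — w8-19936 g10's accounting row «`E Hess_out` = exact 1-form mass» (FINDING-ELITZUR-GLOBALV §2) BY NAME: for a traceless letter field `u` on the bonds of
Bałaban's torus and every `β ≥ 0`,
  `∫ (∂_u∂_u A_W) dμ_β = Σ_p Σ_i ∫ Re(det u_{b_i(p)} · tr U(∂p))∕2 dμ_β + Σ_p [∫ −Re tr word₂(p;0,3)∕2 + ∫ −Re tr word₂(p;3,0)∕2]`
(`actionDeriv₂ = Σ_p Σ_{i,l} −Re tr word₂(p;i,l)∕2`, ✓ 2a): of the sixteen slot pairs of a plaquette, the four DIAGONAL ones are the mass terms (2 × 2 Cayley–Hamilton,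
✓ `trace_word₂_diag`), the two CORNER pairs `{0,3}` (both letters inserted at `p.src`) survive, and the ten pairs with insertions at DISTINCT vertices have mean
zero (✓ `su2_integral_re_trace_word₂_eq_zero`; the vertices `x, x+e_μ, x+e_ν` are pairwise distinct on every torus of the series since `1 ≠ 0` in `ZMod (2L^{m+K})`).

WHAT IS PROVED (ns `…Theorems.UnitScaleGibbsWordTwoElitzurMass`; THEOREMS ONLY, 0 `def`, 0 `sorry`): `slotBond_src` (the four insertion vertices), the ten
distinctness facts (`src_ne_*`), `integral_term_eq_zero` (one off-diagonal pair), `integral_term_diag` (one diagonal pair), and ★★★ `su2_integral_actionDeriv₂_eq_mass_add_corner`.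

HONEST SCOPE.  An exact finite-`β` identity; nothing of `stub_linTest` (nor its redesign), 23083, K1, `HistoryTailL` or any rung is proved; the Yang–Mills mass gap is NOT
proved.
References: S. Elitzur, Phys. Rev. D 12 (1975) 3978 [Elitzur1975]; M. Creutz, Quarks, gluons and lattices, Ch. 11 [Creutz2022]; L. Gross, CMP 92 (1983) Thm 2.2 [GrossCMP1983].
-/

set_option autoImplicit false

noncomputable section
open MeasureTheory
open scoped BigOperators
open Literature.MathematicalPhysics.QuantumFieldTheory.Balaban1983to89
open Literature.MathematicalPhysics.QuantumFieldTheory.Balaban1983to89.T4GenFunBounds (gibbsMeasure isProbabilityMeasure_gibbsMeasure)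
open Literature.MathematicalPhysics.QuantumLattice (fundamentalRep continuous_fundamentalRep)
open Summit.QuantumFields.YangMills.Theorems.UnitScaleGibbsActionDerivativeSlotCalculus
open Summit.QuantumFields.YangMills.Theorems.UnitScaleGibbsWordTwoElitzurSU2

namespace Summit.QuantumFields.YangMills.Theorems.UnitScaleGibbsWordTwoElitzurMass

/-! ## §1 The insertion vertices of the four slots and their distinctness -/

section Vertices

variable {P : Params} {j : ℕ}

/-- The insertion vertices: slots `0` and `3` sit at `x = p.src`, slot `1` at `x + e_μ`, slot `2` at `x + e_ν`. [cite: Creutz2022, Ch. 11] -/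
theorem slotBond_src (p : Plaq P j) :
    (slotBond p 0).src = p.src ∧ (slotBond p 1).src = p.src.shift p.μ ∧ (slotBond p 2).src = p.src.shift p.ν ∧ (slotBond p 3).src = p.src := by
  simp [slotBond]

/-- `y + e_μ ≠ y` on every torus of the series (`1 ≠ 0` in `ZMod (2L^{m+K−j})`). [folklore] -/
private theorem shift_ne_self (y : Site P j) (μ : Fin P.d) : y.shift μ ≠ y := by
  intro h
  have h1 := congrFun h μ
  simp only [Site.shift, Function.update_self] at h1
  exact one_ne_zero (add_eq_left.1 h1)

/-- `y + e_μ ≠ y + e_ν` for `μ ≠ ν`. [folklore] -/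
private theorem shift_ne_shift (y : Site P j) {μ ν : Fin P.d} (hμν : μ ≠ ν) : y.shift μ ≠ y.shift ν := by
  intro h
  have h1 := congrFun h μ
  simp only [Site.shift, Function.update_self, Function.update_of_ne hμν] at h1
  exact one_ne_zero (add_eq_left.1 h1)

/-- The ten slot pairs whose insertion vertices DIFFER: all `(i, l)` with `i ≠ l` except the corner pairs `(0,3)`, `(3,0)`. [cite: Creutz2022, Ch. 11] -/
theorem src_ne (p : Plaq P j) :
    (slotBond p 0).src ≠ (slotBond p 1).src ∧ (slotBond p 0).src ≠ (slotBond p 2).src ∧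
    (slotBond p 1).src ≠ (slotBond p 0).src ∧ (slotBond p 1).src ≠ (slotBond p 2).src ∧ (slotBond p 1).src ≠ (slotBond p 3).src ∧
    (slotBond p 2).src ≠ (slotBond p 0).src ∧ (slotBond p 2).src ≠ (slotBond p 1).src ∧ (slotBond p 2).src ≠ (slotBond p 3).src ∧
    (slotBond p 3).src ≠ (slotBond p 1).src ∧ (slotBond p 3).src ≠ (slotBond p 2).src := by
  obtain ⟨h0, h1, h2, h3⟩ := slotBond_src p
  have hμν : p.μ ≠ p.ν := ne_of_lt p.hμν
  rw [h0, h1, h2, h3]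
  exact ⟨(shift_ne_self p.src p.μ).symm, (shift_ne_self p.src p.ν).symm, shift_ne_self p.src p.μ, shift_ne_shift p.src hμν,
    shift_ne_self p.src p.μ, shift_ne_self p.src p.ν, (shift_ne_shift p.src hμν).symm, shift_ne_self p.src p.ν,
    (shift_ne_self p.src p.μ).symm, (shift_ne_self p.src p.ν).symm⟩

end Vertices

/-! ## §2 The mean of `∂_u∂_u A` for `SU(2)`: mass plus corners -/

section SU2

variable {P : Params}

/-- One OFF-DIAGONAL term of `actionDeriv₂` with insertions at distinct vertices integrates to zero. [cite: Elitzur1975, §II] -/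
theorem integral_term_eq_zero {β : ℝ} (hβ : 0 ≤ β) (u : PBond P 0 → Matrix (Fin 2) (Fin 2) ℂ) (p : Plaq P 0) (i l : Fin 4)
    (hil : (slotBond p i).src ≠ (slotBond p l).src) (hu : (u (slotBond p i)).trace = 0) :
    ∫ U, -((word₂ (fundamentalRep (Fin 2)) u U p i l).trace.re / ((2 : ℕ) : ℝ)) ∂gibbsMeasure P β = 0 := by
  rw [integral_neg, integral_div, su2_integral_re_trace_word₂_eq_zero hβ u p i l hil hu, zero_div, neg_zero]

/-- One DIAGONAL term of `actionDeriv₂` is the mass term `Re(det u_b · tr U(∂p))∕2`. [folklore] -/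
theorem integral_term_diag {β : ℝ} (u : PBond P 0 → Matrix (Fin 2) (Fin 2) ℂ) (p : Plaq P 0) (i : Fin 4) (hu : (u (slotBond p i)).trace = 0) :
    ∫ U, -((word₂ (fundamentalRep (Fin 2)) u U p i i).trace.re / ((2 : ℕ) : ℝ)) ∂gibbsMeasure P β =
      ∫ U, ((u (slotBond p i)).det * (fundamentalRep (Fin 2) (GaugeField.plaqHol U p)).trace).re / 2 ∂gibbsMeasure P β := by
  refine integral_congr_ae (ae_of_all _ fun U => ?_)
  simp only [trace_word₂_diag (fundamentalRep (Fin 2)) u U p i hu, neg_mul, Complex.neg_re, neg_div, neg_neg, Nat.cast_ofNat]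

/-- ★★★ **THE MEAN OF THE HESSIAN OBSERVABLE OF `SU(2)` LATTICE YANG–MILLS IS MASS PLUS CORNERS — EXACTLY** (`β ≥ 0`, every torus of `Setup`, every TRACELESS
letter field `u`): `∫ actionDeriv₂ u dμ_β = Σ_p Σ_i ∫ Re(det u_{b_i(p)}·tr U(∂p))∕2 dμ_β + Σ_p [∫ −Re tr word₂(p;0,3)∕2 dμ_β + ∫ −Re tr word₂(p;3,0)∕2 dμ_β]`; the ten
off-diagonal non-corner pairs per plaquette drop by Elitzur orthogonality. [cite: Elitzur1975, §II] -/
theorem su2_integral_actionDeriv₂_eq_mass_add_corner {β : ℝ} (hβ : 0 ≤ β) (u : PBond P 0 → Matrix (Fin 2) (Fin 2) ℂ)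
    (hu : ∀ b, (u b).trace = 0) :
    ∫ U, actionDeriv₂ (fundamentalRep (Fin 2)) u U ∂gibbsMeasure P β =
      (∑ p : Plaq P 0, ∑ i : Fin 4,
          ∫ U, ((u (slotBond p i)).det * (fundamentalRep (Fin 2) (GaugeField.plaqHol U p)).trace).re / 2 ∂gibbsMeasure P β)
      + ∑ p : Plaq P 0,
          (∫ U, -((word₂ (fundamentalRep (Fin 2)) u U p 0 3).trace.re / ((2 : ℕ) : ℝ)) ∂gibbsMeasure P β
            + ∫ U, -((word₂ (fundamentalRep (Fin 2)) u U p 3 0).trace.re / ((2 : ℕ) : ℝ)) ∂gibbsMeasure P β) := by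
  haveI : SecondCountableTopology (Matrix.specialUnitaryGroup (Fin 2) ℂ) := by
    haveI := secondCountableTopology_matrix (n := Fin 2)
    exact Topology.IsEmbedding.subtypeVal.secondCountableTopology
  -- every term is integrable
  have hint : ∀ (p : Plaq P 0) (i l : Fin 4),
      Integrable (fun U => -((word₂ (fundamentalRep (Fin 2)) u U p i l).trace.re / ((2 : ℕ) : ℝ))) (gibbsMeasure P β) :=
    fun p i l => ((integrable_re_trace_word₂ (continuous_fundamentalRep (Fin 2)) u hβ p i l).div_const _).neg
  -- sum and integral commute
  have hswap : ∫ U, actionDeriv₂ (fundamentalRep (Fin 2)) u U ∂gibbsMeasure P β =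
      ∑ p : Plaq P 0, ∑ i : Fin 4, ∑ l : Fin 4, ∫ U, -((word₂ (fundamentalRep (Fin 2)) u U p i l).trace.re / ((2 : ℕ) : ℝ)) ∂gibbsMeasure P β := by
    unfold actionDeriv₂
    rw [integral_finsetSum _ fun p _ => integrable_finsetSum _ fun i _ => integrable_finsetSum _ fun l _ => hint p i l]
    refine Finset.sum_congr rfl fun p _ => ?_
    rw [integral_finsetSum _ fun i _ => integrable_finsetSum _ fun l _ => hint p i l]
    refine Finset.sum_congr rfl fun i _ => ?_
    exact integral_finsetSum _ fun l _ => hint p i l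
  rw [hswap, ← Finset.sum_add_distrib]
  refine Finset.sum_congr rfl fun p _ => ?_
  obtain ⟨h01, h02, h10, h12, h13, h20, h21, h23, h31, h32⟩ := src_ne p
  have z := fun i l (h : (slotBond p i).src ≠ (slotBond p l).src) => integral_term_eq_zero hβ u p i l h (hu _)
  have d := fun i => integral_term_diag (β := β) u p i (hu (slotBond p i))
  simp only [Fin.sum_univ_four, z 0 1 h01, z 0 2 h02, z 1 0 h10, z 1 2 h12, z 1 3 h13, z 2 0 h20, z 2 1 h21, z 2 3 h23, z 3 1 h31, z 3 2 h32,
    d 0, d 1, d 2, d 3]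
  ring

end SU2

end Summit.QuantumFields.YangMills.Theorems.UnitScaleGibbsWordTwoElitzurMass
end
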